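import Literature.AlgebraicGeometry.HodgeTheory.RibetTypeOfCorePowersHodgeClasses
import Literature.AlgebraicGeometry.Motives.HodgeThetaSubalgebraUnitaryCoprimeStep
import HarnessLib

/-!
# Hodge classes on all powers of abelian varieties of Ribet type `(4,5)`, `(5,7)`, `(6,7)` (and `(4,7)`, `(4,11)` again)
# are generated by divisor classes — Ribet 1983 Thm. 3 at these multiplicities, UNCONDITIONAL

Family `hodge`, layer `Literature/AlgebraicGeometry/HodgeTheory`. Research context: cell `pub-hodge-ring2` (HONEST
FRAMING: research route conditional on HC_CM; not a corollary; Q11.4-sentence-2 already refuted in dim ≥ 3),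
Literature lane gen 83, programme R64. UNCONDITIONAL for the class of abelian varieties it names; theorems only, no
definition, no named fact (D-0026), no `sorry`. The CELLS of the generic assembly `RibetTypeOfCorePowersHodgeClasses`
(`AbelianVariety.isDivisorGenerated_powSucc_of_ribetType_ofCore`: Ribet type `(n′, n″)` + the complex Hermitian core of
type `(n′ | n″)` ⟹ `B = D` on all powers) at the classification-free cores of `Motives/HodgeThetaSubalgebraUnitaryCoprimeStep`:
`(4,5)` — abelian NINEFOLDS; `(5,7)` — TWELVEFOLDS; `(6,7)` — THIRTEENFOLDS (prime dimension `13`: the Tankeev–Ribet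
residual in dimension `13` loses the signatures `(6,7)`/`(7,6)`).

THE PRINTED THEOREM. Ribet, Amer. J. Math. 105 (1983), Thm. 3 = Gordon's survey Thm. 6.3 (3) [held
`paper:arxiv-alg-geom_9709030` p. 18]: `End⁰ = k` imaginary quadratic, multiplicities `(n′, n″)` coprime ⟹ `Hg = U(V, φ)`
and `B•(Aⁿ) = D•(Aⁿ)` for all `n`.

## References
* [Ribet1983] K. A. Ribet, Amer. J. Math. 105 (1983), Thm. 0, Thm. 3.
* [Gordon1997] B. B. Gordon, *A survey of the Hodge conjecture for abelian varieties*, Thm. 6.3 (3) and Corollary.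
* [MoonenZarhin1999LowDim] B. Moonen, Yu. Zarhin, Math. Ann. 315 (1999), §2 (2.4), Thm. (2.7).
* [Deligne2000] P. Deligne, *The Hodge conjecture* (Clay, 2000), §1.
-/

noncomputable section

open CategoryTheory Module

namespace Literature.AlgebraicGeometry.HodgeTheory

open Literature.AlgebraicGeometry.Motives
open Literature.AlgebraicGeometry.Motives.HodgeStructure

section Cells

/-- **Ribet 1983 Thm. 3 at `(4, 5)` — abelian NINEFOLDS with `End⁰ = k` imaginary quadratic acting with multiplicities
`(4,5)` or `(5,4)`: `B•(A^{N+1}) = D•(A^{N+1}) ⊗ ℂ` for all `N`, UNCONDITIONAL** (core `UnitaryCoprimeStep.eq_top_four_five` /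
`eq_top_five_four`). [cite: Ribet1983, Thm. 0 and Thm. 3] [cite: Gordon1997, Thm. 6.3 (3) and Corollary] -/
theorem AbelianVariety.isDivisorGenerated_powSucc_of_ninefold_fourFive (A : AbelianVariety ℂ) (φ : A ⟶ A)
    {d : ℕ} (hd : 0 < d) (hφ : φ ≫ φ = -(d • 𝟙 A)) (hE2 : Module.finrank ℚ A.endAlgebra = 2) (hdim : A.dim = 9)
    (h4 : eigenMultiplicity A φ (Complex.I * (Real.sqrt d : ℂ)) = 4 ∨
      eigenMultiplicity A φ (-(Complex.I * (Real.sqrt d : ℂ))) = 4) (N : ℕ) :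
    IsDivisorGenerated (A.powSucc N) := by
  have hsum := eigenMultiplicity_add_eigenMultiplicity_neg_eq_dim A φ hd hφ
  refine AbelianVariety.isDivisorGenerated_powSucc_of_ribetType_ofCore A φ hd hφ hE2 (by omega) (by omega) ?_ N
  intro W' _ _ _ 𝔊 ι P' Q' s hbr hirr hι hιι hP' hQ' hfinP' hfinQ' hadd hsymm hPQ hdefP hdefQ hadj
  rcases h4 with h | h
  · exact UnitaryCoprimeStep.eq_top_four_five hbr hirr hι hιι hP' hQ' (by rw [hfinP', h]) (by rw [hfinQ']; omega)
      hadd hsymm hPQ hdefP hdefQ hadj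
  · exact UnitaryCoprimeStep.eq_top_five_four hbr hirr hι hιι hP' hQ' (by rw [hfinP']; omega) (by rw [hfinQ', h])
      hadd hsymm hPQ hdefP hdefQ hadj

/-- **The Hodge conjecture for all powers of an abelian NINEFOLD of unitary type `(4,5)` / `(5,4)` — UNCONDITIONAL.**
[cite: Ribet1983, Thm. 3] [cite: Deligne2000, §1] -/
theorem hodgeConjectureFor_powSucc_of_ninefold_fourFive (A : AbelianVariety ℂ) (φ : A ⟶ A)
    {d : ℕ} (hd : 0 < d) (hφ : φ ≫ φ = -(d • 𝟙 A)) (hE2 : Module.finrank ℚ A.endAlgebra = 2) (hdim : A.dim = 9)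
    (h4 : eigenMultiplicity A φ (Complex.I * (Real.sqrt d : ℂ)) = 4 ∨
      eigenMultiplicity A φ (-(Complex.I * (Real.sqrt d : ℂ))) = 4) (N : ℕ) :
    HodgeConjectureFor (A.powSucc N).dim (A.powSucc N).X :=
  hodgeConjectureFor_of_isDivisorGenerated _
    (AbelianVariety.isDivisorGenerated_powSucc_of_ninefold_fourFive A φ hd hφ hE2 hdim h4 N)

/-- **Ribet 1983 Thm. 3 at `(5, 7)` — abelian TWELVEFOLDS of unitary type `(5,7)` / `(7,5)`: `B = D` on all powers,
UNCONDITIONAL** (core `UnitaryCoprimeStep.eq_top_five_seven` / `eq_top_seven_five`).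
[cite: Ribet1983, Thm. 0 and Thm. 3] [cite: Gordon1997, Thm. 6.3 (3) and Corollary] -/
theorem AbelianVariety.isDivisorGenerated_powSucc_of_twelvefold_fiveSeven (A : AbelianVariety ℂ) (φ : A ⟶ A)
    {d : ℕ} (hd : 0 < d) (hφ : φ ≫ φ = -(d • 𝟙 A)) (hE2 : Module.finrank ℚ A.endAlgebra = 2) (hdim : A.dim = 12)
    (h5 : eigenMultiplicity A φ (Complex.I * (Real.sqrt d : ℂ)) = 5 ∨
      eigenMultiplicity A φ (-(Complex.I * (Real.sqrt d : ℂ))) = 5) (N : ℕ) :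
    IsDivisorGenerated (A.powSucc N) := by
  have hsum := eigenMultiplicity_add_eigenMultiplicity_neg_eq_dim A φ hd hφ
  refine AbelianVariety.isDivisorGenerated_powSucc_of_ribetType_ofCore A φ hd hφ hE2 (by omega) (by omega) ?_ N
  intro W' _ _ _ 𝔊 ι P' Q' s hbr hirr hι hιι hP' hQ' hfinP' hfinQ' hadd hsymm hPQ hdefP hdefQ hadj
  rcases h5 with h | h
  · exact UnitaryCoprimeStep.eq_top_five_seven hbr hirr hι hιι hP' hQ' (by rw [hfinP', h]) (by rw [hfinQ']; omega)
      hadd hsymm hPQ hdefP hdefQ hadj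
  · exact UnitaryCoprimeStep.eq_top_seven_five hbr hirr hι hιι hP' hQ' (by rw [hfinP']; omega) (by rw [hfinQ', h])
      hadd hsymm hPQ hdefP hdefQ hadj

/-- **The Hodge conjecture for all powers of an abelian TWELVEFOLD of unitary type `(5,7)` / `(7,5)` — UNCONDITIONAL.**
[cite: Ribet1983, Thm. 3] [cite: Deligne2000, §1] -/
theorem hodgeConjectureFor_powSucc_of_twelvefold_fiveSeven (A : AbelianVariety ℂ) (φ : A ⟶ A)
    {d : ℕ} (hd : 0 < d) (hφ : φ ≫ φ = -(d • 𝟙 A)) (hE2 : Module.finrank ℚ A.endAlgebra = 2) (hdim : A.dim = 12)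
    (h5 : eigenMultiplicity A φ (Complex.I * (Real.sqrt d : ℂ)) = 5 ∨
      eigenMultiplicity A φ (-(Complex.I * (Real.sqrt d : ℂ))) = 5) (N : ℕ) :
    HodgeConjectureFor (A.powSucc N).dim (A.powSucc N).X :=
  hodgeConjectureFor_of_isDivisorGenerated _
    (AbelianVariety.isDivisorGenerated_powSucc_of_twelvefold_fiveSeven A φ hd hφ hE2 hdim h5 N)

/-- **Ribet 1983 Thm. 3 at `(6, 7)` — abelian THIRTEENFOLDS (prime dimension `13`) of unitary type `(6,7)` / `(7,6)`:
`B = D` on all powers, UNCONDITIONAL** (core `UnitaryCoprimeStep.eq_top_six_seven` / `eq_top_seven_six`).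
[cite: Ribet1983, Thm. 0 and Thm. 3] [cite: Gordon1997, Thm. 6.3 (3) and Corollary] [cite: MoonenZarhin1999LowDim, Thm. (2.7)] -/
theorem AbelianVariety.isDivisorGenerated_powSucc_of_thirteenfold_sixSeven (A : AbelianVariety ℂ) (φ : A ⟶ A)
    {d : ℕ} (hd : 0 < d) (hφ : φ ≫ φ = -(d • 𝟙 A)) (hE2 : Module.finrank ℚ A.endAlgebra = 2) (hdim : A.dim = 13)
    (h6 : eigenMultiplicity A φ (Complex.I * (Real.sqrt d : ℂ)) = 6 ∨
      eigenMultiplicity A φ (-(Complex.I * (Real.sqrt d : ℂ))) = 6) (N : ℕ) :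
    IsDivisorGenerated (A.powSucc N) := by
  have hsum := eigenMultiplicity_add_eigenMultiplicity_neg_eq_dim A φ hd hφ
  refine AbelianVariety.isDivisorGenerated_powSucc_of_ribetType_ofCore A φ hd hφ hE2 (by omega) (by omega) ?_ N
  intro W' _ _ _ 𝔊 ι P' Q' s hbr hirr hι hιι hP' hQ' hfinP' hfinQ' hadd hsymm hPQ hdefP hdefQ hadj
  rcases h6 with h | h
  · exact UnitaryCoprimeStep.eq_top_six_seven hbr hirr hι hιι hP' hQ' (by rw [hfinP', h]) (by rw [hfinQ']; omega)
      hadd hsymm hPQ hdefP hdefQ hadj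
  · exact UnitaryCoprimeStep.eq_top_seven_six hbr hirr hι hιι hP' hQ' (by rw [hfinP']; omega) (by rw [hfinQ', h])
      hadd hsymm hPQ hdefP hdefQ hadj

/-- **The Hodge conjecture for all powers of an abelian THIRTEENFOLD of unitary type `(6,7)` / `(7,6)` — UNCONDITIONAL.**
[cite: Ribet1983, Thm. 3] [cite: MoonenZarhin1999LowDim, Thm. (2.7)] [cite: Deligne2000, §1] -/
theorem hodgeConjectureFor_powSucc_of_thirteenfold_sixSeven (A : AbelianVariety ℂ) (φ : A ⟶ A)
    {d : ℕ} (hd : 0 < d) (hφ : φ ≫ φ = -(d • 𝟙 A)) (hE2 : Module.finrank ℚ A.endAlgebra = 2) (hdim : A.dim = 13)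
    (h6 : eigenMultiplicity A φ (Complex.I * (Real.sqrt d : ℂ)) = 6 ∨
      eigenMultiplicity A φ (-(Complex.I * (Real.sqrt d : ℂ))) = 6) (N : ℕ) :
    HodgeConjectureFor (A.powSucc N).dim (A.powSucc N).X :=
  hodgeConjectureFor_of_isDivisorGenerated _
    (AbelianVariety.isDivisorGenerated_powSucc_of_thirteenfold_sixSeven A φ hd hφ hE2 hdim h6 N)

end Cells

end Literature.AlgebraicGeometry.HodgeTheory

end
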